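import Literature.MathematicalPhysics.QuantumLattice.HubbardFreeCovariance
import Mathlib.Analysis.Calculus.MeanValue
import HarnessLib

/-!
# Salmhofer's cutoff is Lipschitz; differences of the slice weights `w_Λ(k) - w_Λ(k′)`

Topic `MathematicalPhysics/QuantumLattice`; companion of `HubbardFreeCovariance.lean` (`salmhoferCutoff = χ₂`, smooth, `0` below `¼`,
`1` above `1`; `hubbardCutoffWeight β μ Λ k = χ₂((ω² + ξ²)/Λ²)`) and of `HubbardShiftedSliceSymbolDifferences.lean` (differences of
the free symbol).  The weighted-Plancherel route to the `L¹` norms of the slice propagators (cell gate-hubbard-kl, R0-SCOPE-2 §5.3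
(W2)) needs discrete differences of the full slice symbol `(w_Λ - w_{Λ′})·p_θ`, hence of the weights: `χ₂` is `C¹` with a derivative
supported in `[¼, 1]`, so it is globally Lipschitz (some constant `L_χ`), and
`|w_Λ(k) - w_Λ(k′)| ≤ L_χ |ω² + ξ² - ω′² - ξ′²|/Λ²` (Salmhofer 1999, §4.2.5: the cutoffs are smooth on scale `Λ`;
Benfatto–Giuliani–Mastropietro 2006, (2.36aa): discrete derivatives on the finite torus).

* `exists_lipschitz_salmhoferCutoff` — `∃ L_χ ≥ 0, ∀ x y, |χ₂ x - χ₂ y| ≤ L_χ |x - y|`;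
* **`exists_abs_hubbardCutoffWeight_sub_le`** — `∃ L_χ ≥ 0`, for all `β μ Λ ≠ 0` and labels `k, k′`:
  `|w_Λ(k) - w_Λ(k′)| ≤ L_χ · |(ω² + ξ²) - (ω′² + ξ′²)| / Λ²`.

Everything is proved; no definitions, no named facts.

## Sources

M. Salmhofer, *Renormalization* (1999), §4.2.5 (4.70)–(4.71) (`Salmhofer1999`); G. Benfatto, A. Giuliani, V. Mastropietro,
Ann. Henri Poincaré 7 (2006) 809–898, (2.36aa) (`BenfattoGiulianiMastropietro2006`).
-/

noncomputable section

namespace Literature.MathematicalPhysics.QuantumLattice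

open Literature.Probability.LatticeModels GrassmannAlgebra Finset Set

/-- **Salmhofer's cutoff is globally Lipschitz**: `∃ L_χ ≥ 0, |χ₂ x - χ₂ y| ≤ L_χ |x - y|` (it is `C¹` and its derivative,
continuous and vanishing off `[¼, 1]`, is bounded). [cite: Salmhofer1999, §4.2.5 (4.71)] -/
theorem exists_lipschitz_salmhoferCutoff :
    ∃ Lχ : ℝ, 0 ≤ Lχ ∧ ∀ x y : ℝ, |salmhoferCutoff x - salmhoferCutoff y| ≤ Lχ * |x - y| := by
  have hC1 : ContDiff ℝ 1 salmhoferCutoff := contDiff_salmhoferCutoff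
  have hdiff : Differentiable ℝ salmhoferCutoff := hC1.differentiable one_ne_zero
  have hcont : Continuous (deriv salmhoferCutoff) := hC1.continuous_deriv le_rfl
  -- the derivative is bounded on the compact interval `[0, 2]` …
  obtain ⟨C, hC⟩ := (isCompact_Icc : IsCompact (Icc (0 : ℝ) 2)).exists_bound_of_continuousOn hcont.continuousOn
  -- … and vanishes outside it (the cutoff is locally constant there)
  have hzero : ∀ x : ℝ, x ∉ Icc (0 : ℝ) 2 → deriv salmhoferCutoff x = 0 := by
    intro x hx
    rw [Set.mem_Icc, not_and_or, not_le, not_le] at hx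
    rcases hx with hx | hx
    · -- `x < 0`: `χ₂ = 0` near `x`
      have hev : salmhoferCutoff =ᶠ[nhds x] fun _ => (0 : ℝ) := by
        filter_upwards [Iio_mem_nhds (show x < 1 / 4 by linarith)] with y hy
        exact salmhoferCutoff_of_le (le_of_lt hy)
      rw [hev.deriv_eq, deriv_const]
    · -- `2 < x`: `χ₂ = 1` near `x`
      have hev : salmhoferCutoff =ᶠ[nhds x] fun _ => (1 : ℝ) := by
        filter_upwards [Ioi_mem_nhds (show (1 : ℝ) < x by linarith)] with y hy
        exact salmhoferCutoff_of_ge (le_of_lt hy)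
      rw [hev.deriv_eq, deriv_const]
  refine ⟨max C 0, le_max_right _ _, fun x y => ?_⟩
  have hbound : ∀ z : ℝ, ‖deriv salmhoferCutoff z‖ ≤ max C 0 := by
    intro z
    by_cases hz : z ∈ Icc (0 : ℝ) 2
    · exact (hC z hz).trans (le_max_left _ _)
    · rw [hzero z hz, norm_zero]; exact le_max_right _ _
  have h := Convex.norm_image_sub_le_of_norm_deriv_le (fun z _ => hdiff.differentiableAt) (fun z _ => hbound z)
    convex_univ (Set.mem_univ y) (Set.mem_univ x)
  rw [Real.norm_eq_abs, Real.norm_eq_abs] at h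
  exact h

/-- **Differences of the slice weights**: there is `L_χ ≥ 0` such that for all `β, μ`, all `Λ ≠ 0` and all labels `k, k′`,
`|w_Λ(k) - w_Λ(k′)| ≤ L_χ |(ω² + ξ²) - (ω′² + ξ′²)| / Λ²` — a frequency step `2π/β` or a momentum step on a slice of scale `Λ′`
costs `≲ Λ′·step/Λ²`. [cite: BenfattoGiulianiMastropietro2006, (2.36aa)] -/
theorem exists_abs_hubbardCutoffWeight_sub_le :
    ∃ Lχ : ℝ, 0 ≤ Lχ ∧ ∀ (L M : ℕ) (β μ Λ : ℝ), Λ ≠ 0 → ∀ k k' : FreqMomentum L M,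
      |hubbardCutoffWeight L M β μ Λ k - hubbardCutoffWeight L M β μ Λ k'| ≤
        Lχ * |(matsubaraFreq β M k.1 ^ 2 + nambuXi L μ k.2 ^ 2) - (matsubaraFreq β M k'.1 ^ 2 + nambuXi L μ k'.2 ^ 2)| / Λ ^ 2 := by
  obtain ⟨Lχ, hL0, hL⟩ := exists_lipschitz_salmhoferCutoff
  refine ⟨Lχ, hL0, fun L M β μ Λ hΛ k k' => ?_⟩
  rw [hubbardCutoffWeight, hubbardCutoffWeight]
  refine (hL _ _).trans (le_of_eq ?_)
  have hΛ2 : 0 < Λ ^ 2 := by positivity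
  rw [← sub_div, abs_div, abs_of_pos hΛ2, mul_div_assoc]

end Literature.MathematicalPhysics.QuantumLattice

end
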